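import Mathlib
import Summits.NavierStokesRegularity.FluidComputer.BorderedEigenpairApproxInverse
import Summits.NavierStokesRegularity.FluidComputer.BorderedEigenpairPairingSections
import Summits.NavierStokesRegularity.FluidComputer.SkewCutGalerkinFromResolventData

/-!
# The GROUP-B END-TO-END theorems and the GROUP-A bracket-end injectivity FROM
# APPROXIMATE-INVERSE DATA
(profile-cert-3 g7, cell `ns-blowup`, 2026-08-27)

HONEST FRAMING (human rulings D-0035/D-0074): nothing here is a claim about Navier–Stokes
blow-up. WHAT THIS IS NOT: not NS evidence. MODEL lane bookkeeping about the FORMAT of the F5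
certificates (GROUP B: `CertificateAbcSpectrum*` eigenpair rows, `CertificateAbcResolvent*`
non-resonance rows; GROUP A: the Theorem-R data at the two bracket ends). No certificate, number
or census word is moved. Sequel of `CertifierApproxInverse` / `BorderedEigenpairApproxInverse`.

§5 restates, with the posited EXACT left inverse `Binv` and its bounds REPLACED by the
certifiers' float-inverse data (`X̃`, `θ < 1`, the printed norms, the shell constant for `X̃`'s
block) and the displayed derived constants:
* `certified_eigenpair_of_sections_nested_of_approx_inverse` ⇐
  `BorderedEigenpairPairingSections.certified_eigenpair_of_sections_nested_of_sections` (p471063);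
* `resolvent_inverse_of_sections_of_approx_inverse` ⇐ `…resolvent_inverse_of_sections_of_sections`;
* `resolventCoord_injective_of_approx_inverse` ⇐
  `SkewCutGalerkinFromResolventData.resolventCoord_injective_of_sections` (p475252; use at both
  bracket ends of `SkewCutGalerkinFromSections.exists_smooth_eigenvector_Ioo_of_sections'`).
Every other hypothesis and every conclusion verbatim. After these, residue (i) of a 3-B /
Theorem-R row reads: the program's interval arithmetic over the exact assembly is sound for the
printed `X̃`-data — no exact-inverse object is left on paper. Mathlib + the files named; no new
definitions. bears_on LADDER-NS N5 / Z4-a(1)(2), N1* ⟦I-X0⟧; evidence-only for `EpisodeBase`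
(stmt-NavierStokesRegularity-19179). [folklore] throughout.
-/

noncomputable section

namespace Summit.NavierStokesRegularity.FluidComputer.BorderedEigenpairFromApproxInverse

open Finset CertifierApproxInverse BorderedEigenpairApproxInverse
open scoped InnerProductSpace ComplexConjugate

/-! ## §5 END-TO-END corollaries: the GROUP-B theorems and the GROUP-A end-injectivity from `X̃`-data -/

section EndToEnd

open Filter Topology Submodule

variable {𝕜 H : Type*} [RCLike 𝕜] [NormedAddCommGroup H] [InnerProductSpace 𝕜 H] [CompleteSpace H]
variable {ι : Type*} (b : HilbertBasis ι 𝕜 H) [DecidableEq ι]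

/-- **3-B-NESTED END-TO-END FROM APPROXIMATE-INVERSE DATA.**
`BorderedEigenpairPairingSections.certified_eigenpair_of_sections_nested_of_sections` (p471063)
with the posited exact left inverse `Binv` and its bounds `α, β_B, β_C, g_B` and the `Binv`-shell
inequality REPLACED by the certifiers' float-inverse data (`X`, `θ < 1`, `nX`, `yB`, `nB`, `yC`,
`nC`, `xmu`, `ygB`, shell constant `MU2X` for `X`'s block) and the displayed constants
`α = nX/(1−θ)`, `δ = αθ`, `β_B = yB + nB δ`, `β_C = yC + nC δ + nt (xmu + δ)`, `g_B = ygB + nB δ`,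
`MU2 = MU2X − nB nC δ`; every other hypothesis and the conclusion verbatim. -/
theorem certified_eigenpair_of_sections_nested_of_approx_inverse
    (ℓ : ι → ℝ) (x₀ : ℝ) (d : lp (fun _ : ι => 𝕜) ⊤) (hd : ∀ i, d i * ((x₀ : 𝕜) - (ℓ i : 𝕜)) = 1)
    (hd0 : Tendsto (fun i => ‖d i‖) cofinite (𝓝 0))
    (t : ι → ι → 𝕜) {R₀ C₀ : ℝ} (hrow : ∀ i, Summable fun j => ‖t i j‖)
    (hR : ∀ i, ∑' j, ‖t i j‖ ≤ R₀) (hcol : ∀ j, Summable fun i => ‖t i j‖)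
    (hC₀ : ∀ j, ∑' i, ‖t i j‖ ≤ C₀) (hR0 : 0 ≤ R₀) (hC0 : 0 ≤ C₀) (hq : R₀ * C₀ < 1)
    (nbr : ι → Finset ι) (hsymm : ∀ i j, j ∈ nbr i ↔ i ∈ nbr j)
    (ht0 : ∀ i j, j ∉ nbr i → t i j = 0)
    (lt : 𝕜) (K Kv : Finset ι) (vt : ι → 𝕜) (hvt0 : ∀ i, i ∉ Kv → vt i = 0)
    {r₀ nt : ℝ} (hr₀ : 0 ≤ r₀) (hnt : 0 ≤ nt)
    (hres : ∑ i ∈ Kv ∪ Kv.biUnion nbr, ‖(if i ∈ Kv then (lt - (ℓ i : 𝕜)) * vt i else 0) -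
        ∑ j ∈ Kv, (t i j * ((x₀ : 𝕜) - (ℓ j : 𝕜))) * vt j‖ ^ 2 ≤ r₀ ^ 2)
    (hntb : ∑ i ∈ Kv \ K, ‖vt i‖ ^ 2 ≤ nt ^ 2)
    -- the float inverse `X̃` of the bordered Galerkin matrix and its certified data
    (X : ((K → 𝕜) × 𝕜) →ₗ[𝕜] ((K → 𝕜) × 𝕜))
    {θ nX yB nB yC nC xmu ygB MU2X : ℝ}
    (hθ0 : 0 ≤ θ) (hθ1 : θ < 1) (hnX0 : 0 ≤ nX) (hyB0 : 0 ≤ yB) (hnB0 : 0 ≤ nB)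
    (hyC0 : 0 ≤ yC) (hnC0 : 0 ≤ nC) (hxmu0 : 0 ≤ xmu) (hygB0 : 0 ≤ ygB)
    (hθ : ∀ (c : K → 𝕜) (m : 𝕜),
      ∑ j : K, ‖c j - (X (fun i : K => (lt - (ℓ i : 𝕜)) * c i -
          ∑ j : K, (t i j * ((x₀ : 𝕜) - (ℓ j : 𝕜))) * c j + m * vt i,
          ∑ i : K, conj (vt i) * c i)).1 j‖ ^ 2 +
        ‖m - (X (fun i : K => (lt - (ℓ i : 𝕜)) * c i -
          ∑ j : K, (t i j * ((x₀ : 𝕜) - (ℓ j : 𝕜))) * c j + m * vt i,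
          ∑ i : K, conj (vt i) * c i)).2‖ ^ 2 ≤
        θ ^ 2 * (∑ j : K, ‖c j‖ ^ 2 + ‖m‖ ^ 2))
    (hnX : ∀ (c : K → 𝕜) (g : 𝕜),
      ∑ j : K, ‖(X (c, g)).1 j‖ ^ 2 + ‖(X (c, g)).2‖ ^ 2 ≤
        nX ^ 2 * (∑ j : K, ‖c j‖ ^ 2 + ‖g‖ ^ 2))
    (hyB : ∀ e : ι → 𝕜,
      ∑ j : K, ‖(X (fun i : K => -∑ j ∈ nbr i \ K,
          (t i j * ((x₀ : 𝕜) - (ℓ j : 𝕜))) * e j, 0)).1 j‖ ^ 2 +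
        ‖(X (fun i : K => -∑ j ∈ nbr i \ K,
          (t i j * ((x₀ : 𝕜) - (ℓ j : 𝕜))) * e j, 0)).2‖ ^ 2 ≤
        yB ^ 2 * ∑ j ∈ K.biUnion nbr \ K, ‖e j‖ ^ 2)
    (hnB : ∀ e : ι → 𝕜,
      ∑ i : K, ‖∑ j ∈ nbr i \ K, (t i j * ((x₀ : 𝕜) - (ℓ j : 𝕜))) * e j‖ ^ 2 ≤
        nB ^ 2 * ∑ j ∈ K.biUnion nbr \ K, ‖e j‖ ^ 2)
    (hyC : ∀ (c : K → 𝕜) (g : 𝕜),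
      ∑ i ∈ (K.biUnion nbr ∪ Kv) \ K,
        ‖∑ j : K, (t i j * ((x₀ : 𝕜) - (ℓ j : 𝕜))) * (X (c, g)).1 j‖ ^ 2 ≤
        yC ^ 2 * (∑ j : K, ‖c j‖ ^ 2 + ‖g‖ ^ 2))
    (hnC : ∀ z : K → 𝕜,
      ∑ i ∈ (K.biUnion nbr ∪ Kv) \ K, ‖∑ j : K, (t i j * ((x₀ : 𝕜) - (ℓ j : 𝕜))) * z j‖ ^ 2 ≤
        nC ^ 2 * ∑ j : K, ‖z j‖ ^ 2)
    (hxmu : ∀ (c : K → 𝕜) (g : 𝕜),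
      ‖(X (c, g)).2‖ ^ 2 ≤ xmu ^ 2 * (∑ j : K, ‖c j‖ ^ 2 + ‖g‖ ^ 2))
    (hygB : ∀ e : ι → 𝕜,
      ‖(X (fun i : K => ∑ j ∈ nbr i \ K, (t i j * ((x₀ : 𝕜) - (ℓ j : 𝕜))) * e j, 0)).2‖ ^ 2 ≤
        ygB ^ 2 * ∑ j ∈ K.biUnion nbr \ K, ‖e j‖ ^ 2)
    {s : ℝ} (sh : Finset ι) (hKsh : K.biUnion nbr \ K ⊆ sh)
    (hshellX : ∀ e : ι → 𝕜, (∀ i ∈ K, e i = 0) →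
      MU2X * ∑ i ∈ sh, ‖e i‖ ^ 2 ≤ ∑ i ∈ sh, (RCLike.re lt - ℓ i - s) * ‖e i‖ ^ 2 -
        RCLike.re (∑ i ∈ K.biUnion nbr \ K,
          conj (∑ j : K, (t i j * ((x₀ : 𝕜) - (ℓ j : 𝕜))) *
            (X (fun i : K => ∑ j ∈ nbr i \ K, (t i j * ((x₀ : 𝕜) - (ℓ j : 𝕜))) * e j, 0)).1 j) *
          e i))
    -- the derived constants and the closing inequalities
    {α δ βB βC gB MU2 μ M : ℝ} (hαdef : α = nX / (1 - θ)) (hδdef : δ = α * θ)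
    (hβBdef : βB = yB + nB * δ) (hβCdef : βC = yC + nC * δ + nt * (xmu + δ))
    (hgBdef : gB = ygB + nB * δ) (hMU2def : MU2 = MU2X - nB * nC * δ)
    (htail : ∀ i, i ∉ K → i ∉ sh → MU2 ≤ RCLike.re lt - ℓ i - s)
    (hμdef : μ = MU2 - gB * nt) (hμ : 0 < μ)
    (hMdef : M = √((1 + βC ^ 2) / μ ^ 2 + (α + βB * √(1 + βC ^ 2) / μ) ^ 2))
    (hκ : 2 * Real.sqrt 2 * M ^ 2 * r₀ < 1)
    (hA : ∀ (F : Finset ι) (e : ι → 𝕜),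
      RCLike.re (∑ i ∈ F, ∑ j ∈ F, conj (e i) * (t i j * ((x₀ : 𝕜) - (ℓ j : 𝕜))) * e j) ≤
        s * ∑ i ∈ F, ‖e i‖ ^ 2) :
    ∃ T : H →L[𝕜] H, (∀ i j, ⟪b i, T (b j)⟫_𝕜 = t i j) ∧ ‖T‖ ≤ Real.sqrt (R₀ * C₀) ∧
    ∃ lam : 𝕜, ∃ ws : H,
      (((1 : H →L[𝕜] H) - T - ((x₀ : 𝕜) - lam) • b.diagonalCLM d) ws = 0 ∧
        ‖b.diagonalCLM d ws - ∑ j ∈ Kv, vt j • b j‖ ^ 2 + ‖lam - lt‖ ^ 2 ≤ (2 * M * r₀) ^ 2 ∧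
        ⟪∑ i ∈ K, vt i • b i, b.diagonalCLM d ws⟫_𝕜 = ⟪∑ i ∈ K, vt i • b i, ∑ j ∈ Kv, vt j • b j⟫_𝕜) ∧
      (∀ (lam' : 𝕜) (w' : H), ((1 : H →L[𝕜] H) - T - ((x₀ : 𝕜) - lam') • b.diagonalCLM d) w' = 0 →
        ‖b.diagonalCLM d w' - ∑ j ∈ Kv, vt j • b j‖ ^ 2 + ‖lam' - lt‖ ^ 2 ≤ (2 * M * r₀) ^ 2 →
        ⟪∑ i ∈ K, vt i • b i, b.diagonalCLM d w'⟫_𝕜 = ⟪∑ i ∈ K, vt i • b i, ∑ j ∈ Kv, vt j • b j⟫_𝕜 →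
        lam' = lam ∧ w' = ws) ∧
      (∀ y : H, ((1 : H →L[𝕜] H) - T - ((x₀ : 𝕜) - lam) • b.diagonalCLM d) y = 0 →
        y = (⟪∑ i ∈ K, vt i • b i, b.diagonalCLM d y⟫_𝕜 /
          ⟪∑ i ∈ K, vt i • b i, b.diagonalCLM d ws⟫_𝕜) • ws) ∧
      (∀ y₁ y₂ : H, ((1 : H →L[𝕜] H) - T - ((x₀ : 𝕜) - lam) • b.diagonalCLM d) y₁ =
          b.diagonalCLM d y₂ →
        ((1 : H →L[𝕜] H) - T - ((x₀ : 𝕜) - lam) • b.diagonalCLM d) y₂ = 0 → y₂ = 0) ∧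
      (∀ z : 𝕜, z ≠ lam → ‖z - lam‖ < (1 - 2 * Real.sqrt 2 * M ^ 2 * r₀) / M →
        IsUnit ((1 : H →L[𝕜] H) - T - ((x₀ : 𝕜) - z) • b.diagonalCLM d)) := by
  have hKc : K.biUnion nbr \ K ⊆ (K.biUnion nbr ∪ Kv) \ K :=
    Finset.sdiff_subset_sdiff Finset.subset_union_left le_rfl
  have hntc : ∑ i ∈ (K.biUnion nbr ∪ Kv) \ K, ‖vt i‖ ^ 2 ≤ nt ^ 2 := by
    rw [← Finset.sum_subset (Finset.sdiff_subset_sdiff Finset.subset_union_right le_rfl)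
      (fun i hi hi' => by
        rw [Finset.mem_sdiff] at hi hi'
        have : i ∉ Kv := fun h => hi' ⟨h, hi.2⟩
        rw [hvt0 i this, norm_zero, zero_pow two_ne_zero])]
    exact hntb
  obtain ⟨Binv, hBinv, hαM, hβBM, hβCM, hgBM, hshellM⟩ :=
    exists_borderedInverse_of_approx K nbr ((K.biUnion nbr ∪ Kv) \ K) sh hKc hKsh
      (fun i j => t i j * ((x₀ : 𝕜) - (ℓ j : 𝕜))) (fun i => lt - (ℓ i : 𝕜)) vt
      (fun i => RCLike.re lt - ℓ i - s) X hθ0 hθ1 hnX0 hyB0 hnB0 hyC0 hnC0 hxmu0 hygB0 hnt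
      hθ hnX hyB hnB hyC hnC hxmu hygB hntc hshellX hαdef hδdef hβBdef hβCdef hgBdef hMU2def
  have hα : 0 ≤ α := by rw [hαdef]; exact div_nonneg hnX0 (by linarith)
  have hδ : 0 ≤ δ := by rw [hδdef]; positivity
  have hβB : 0 ≤ βB := by rw [hβBdef]; positivity
  have hβC : 0 ≤ βC := by rw [hβCdef]; positivity
  have hgB : 0 ≤ gB := by rw [hgBdef]; positivity
  exact BorderedEigenpairPairingSections.certified_eigenpair_of_sections_nested_of_sections b ℓ x₀
    d hd hd0 t hrow hR hcol hC₀ hR0 hC0 hq nbr hsymm ht0 lt K Kv vt hvt0 hr₀ hnt hres hntb Binv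
    hBinv hα hβB hβC hgB hαM hβBM hβCM hgBM sh hshellM htail hμdef hμ hMdef hκ hA

/-- **THEOREM R END-TO-END FROM APPROXIMATE-INVERSE DATA.**
`BorderedEigenpairPairingSections.resolvent_inverse_of_sections_of_sections` (p471063) with the
posited exact left inverse `Binv`, its bounds `α, β_B, β_C` and the `Binv`-shell inequality
REPLACED by the float-inverse data (`X`, `θ < 1`, `nX`, `yB`, `nB`, `yC`, `nC`, `MU2X`) and the
constants `α = nX/(1−θ)`, `δ = αθ`, `β_B = yB + nB δ`, `β_C = yC + nC δ`, `MU2 = MU2X − nB nC δ > 0`;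
every other hypothesis and the conclusion verbatim (cert3.py `run_resolvent`). -/
theorem resolvent_inverse_of_sections_of_approx_inverse
    (ℓ : ι → ℝ) (x₀ : ℝ) (d : lp (fun _ : ι => 𝕜) ⊤) (hd : ∀ i, d i * ((x₀ : 𝕜) - (ℓ i : 𝕜)) = 1)
    (hd0 : Tendsto (fun i => ‖d i‖) cofinite (𝓝 0))
    (t : ι → ι → 𝕜) {R₀ C₀ : ℝ} (hrow : ∀ i, Summable fun j => ‖t i j‖)
    (hR : ∀ i, ∑' j, ‖t i j‖ ≤ R₀) (hcol : ∀ j, Summable fun i => ‖t i j‖)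
    (hC₀ : ∀ j, ∑' i, ‖t i j‖ ≤ C₀) (hR0 : 0 ≤ R₀) (hC0 : 0 ≤ C₀) (hq : R₀ * C₀ < 1)
    (nbr : ι → Finset ι) (hsymm : ∀ i j, j ∈ nbr i ↔ i ∈ nbr j)
    (ht0 : ∀ i j, j ∉ nbr i → t i j = 0)
    (z : 𝕜) (K : Finset ι)
    -- the float inverse `X̃` of the Galerkin matrix `z − L_K` and its certified data
    (X : (K → 𝕜) →ₗ[𝕜] (K → 𝕜))
    {θ nX yB nB yC nC MU2X : ℝ}
    (hθ0 : 0 ≤ θ) (hθ1 : θ < 1) (hnX0 : 0 ≤ nX) (hyB0 : 0 ≤ yB) (hnB0 : 0 ≤ nB)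
    (hyC0 : 0 ≤ yC) (hnC0 : 0 ≤ nC)
    (hθ : ∀ c : K → 𝕜,
      ∑ j : K, ‖c j - X (fun i : K => (z - (ℓ i : 𝕜)) * c i -
        ∑ j : K, (t i j * ((x₀ : 𝕜) - (ℓ j : 𝕜))) * c j) j‖ ^ 2 ≤ θ ^ 2 * ∑ j : K, ‖c j‖ ^ 2)
    (hnX : ∀ c : K → 𝕜, ∑ j : K, ‖X c j‖ ^ 2 ≤ nX ^ 2 * ∑ j : K, ‖c j‖ ^ 2)
    (hyB : ∀ e : ι → 𝕜,
      ∑ j : K, ‖X (fun i : K => -∑ j ∈ nbr i \ K, (t i j * ((x₀ : 𝕜) - (ℓ j : 𝕜))) * e j) j‖ ^ 2 ≤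
        yB ^ 2 * ∑ j ∈ K.biUnion nbr \ K, ‖e j‖ ^ 2)
    (hnB : ∀ e : ι → 𝕜,
      ∑ i : K, ‖∑ j ∈ nbr i \ K, (t i j * ((x₀ : 𝕜) - (ℓ j : 𝕜))) * e j‖ ^ 2 ≤
        nB ^ 2 * ∑ j ∈ K.biUnion nbr \ K, ‖e j‖ ^ 2)
    (hyC : ∀ c : K → 𝕜,
      ∑ i ∈ K.biUnion nbr \ K, ‖∑ j : K, (t i j * ((x₀ : 𝕜) - (ℓ j : 𝕜))) * X c j‖ ^ 2 ≤
        yC ^ 2 * ∑ j : K, ‖c j‖ ^ 2)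
    (hnC : ∀ w : K → 𝕜,
      ∑ i ∈ K.biUnion nbr \ K, ‖∑ j : K, (t i j * ((x₀ : 𝕜) - (ℓ j : 𝕜))) * w j‖ ^ 2 ≤
        nC ^ 2 * ∑ j : K, ‖w j‖ ^ 2)
    {s : ℝ} (sh : Finset ι) (hKsh : K.biUnion nbr \ K ⊆ sh)
    (hshellX : ∀ e : ι → 𝕜, (∀ i ∈ K, e i = 0) →
      MU2X * ∑ i ∈ sh, ‖e i‖ ^ 2 ≤ ∑ i ∈ sh, (RCLike.re z - ℓ i - s) * ‖e i‖ ^ 2 -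
        RCLike.re (∑ i ∈ K.biUnion nbr \ K,
          conj (∑ j : K, (t i j * ((x₀ : 𝕜) - (ℓ j : 𝕜))) *
            X (fun i : K => ∑ j ∈ nbr i \ K, (t i j * ((x₀ : 𝕜) - (ℓ j : 𝕜))) * e j) j) *
          e i))
    {α δ βB βC MU2 : ℝ} (hαdef : α = nX / (1 - θ)) (hδdef : δ = α * θ)
    (hβBdef : βB = yB + nB * δ) (hβCdef : βC = yC + nC * δ)
    (hMU2def : MU2 = MU2X - nB * nC * δ) (hMU2 : 0 < MU2)
    (htail : ∀ i, i ∉ K → i ∉ sh → MU2 ≤ RCLike.re z - ℓ i - s)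
    (hA : ∀ (F : Finset ι) (e : ι → 𝕜),
      RCLike.re (∑ i ∈ F, ∑ j ∈ F, conj (e i) * (t i j * ((x₀ : 𝕜) - (ℓ j : 𝕜))) * e j) ≤
        s * ∑ i ∈ F, ‖e i‖ ^ 2) :
    ∃ T : H →L[𝕜] H, (∀ i j, ⟪b i, T (b j)⟫_𝕜 = t i j) ∧ ‖T‖ ≤ Real.sqrt (R₀ * C₀) ∧
    ∃ Rinv : H →L[𝕜] H,
      (∀ f, ((1 : H →L[𝕜] H) - T - ((x₀ : 𝕜) - z) • b.diagonalCLM d) (Rinv f) = f) ∧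
      (∀ w, Rinv (((1 : H →L[𝕜] H) - T - ((x₀ : 𝕜) - z) • b.diagonalCLM d) w) = w) ∧
      ‖b.diagonalCLM d ∘L Rinv‖ ≤
        √((1 + βC ^ 2) / MU2 ^ 2 + (α + βB * √(1 + βC ^ 2) / MU2) ^ 2) ∧
      ∀ f, ‖b.diagonalCLM d (Rinv f)‖ ≤
        √((1 + βC ^ 2) / MU2 ^ 2 + (α + βB * √(1 + βC ^ 2) / MU2) ^ 2) * ‖f‖ := by
  obtain ⟨Binv, hBinv, hαM, hβBM, hβCM, hshellM⟩ :=
    exists_headInverse_of_approx K nbr (K.biUnion nbr \ K) sh le_rfl hKsh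
      (fun i j => t i j * ((x₀ : 𝕜) - (ℓ j : 𝕜))) (fun i => z - (ℓ i : 𝕜))
      (fun i => RCLike.re z - ℓ i - s) X hθ0 hθ1 hnX0 hyB0 hnB0 hyC0 hnC0
      hθ hnX hyB hnB hyC hnC hshellX hαdef hδdef hβBdef hβCdef hMU2def
  have hα : 0 ≤ α := by rw [hαdef]; exact div_nonneg hnX0 (by linarith)
  have hδ : 0 ≤ δ := by rw [hδdef]; positivity
  have hβB : 0 ≤ βB := by rw [hβBdef]; positivity
  have hβC : 0 ≤ βC := by rw [hβCdef]; positivity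
  exact BorderedEigenpairPairingSections.resolvent_inverse_of_sections_of_sections b ℓ x₀ d hd hd0
    t hrow hR hcol hC₀ hR0 hC0 hq nbr hsymm ht0 z K Binv hBinv hα hβB hβC hαM hβBM hβCM hMU2 sh
    hshellM htail hA

/-- **Bracket-end injectivity FROM APPROXIMATE-INVERSE DATA** (the GROUP-A input):
`SkewCutGalerkinFromResolventData.resolventCoord_injective_of_sections` (p475252) with the
Theorem-R matrix data `Binv, α, β_B, β_C`, shell inequality REPLACED by float-inverse data as in
`resolvent_inverse_of_sections_of_approx_inverse`; conclusion verbatim (`R_z` injective for the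
unique bounded `T'` with matrix `t`). Use it at both bracket ends `z = a`, `z = e` to feed
`SkewCutGalerkinFromSections.exists_smooth_eigenvector_Ioo_of_sections'`. -/
theorem resolventCoord_injective_of_approx_inverse
    (ℓ : ι → ℝ) (x₀ : ℝ) (d : lp (fun _ : ι => 𝕜) ⊤) (hd : ∀ i, d i * ((x₀ : 𝕜) - (ℓ i : 𝕜)) = 1)
    (hd0 : Tendsto (fun i => ‖d i‖) cofinite (𝓝 0))
    (t : ι → ι → 𝕜) {R₀ C₀ : ℝ} (hrow : ∀ i, Summable fun j => ‖t i j‖)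
    (hR : ∀ i, ∑' j, ‖t i j‖ ≤ R₀) (hcol : ∀ j, Summable fun i => ‖t i j‖)
    (hC₀ : ∀ j, ∑' i, ‖t i j‖ ≤ C₀) (hR0 : 0 ≤ R₀) (hC0 : 0 ≤ C₀) (hq : R₀ * C₀ < 1)
    (nbr : ι → Finset ι) (hsymm : ∀ i j, j ∈ nbr i ↔ i ∈ nbr j)
    (ht0 : ∀ i j, j ∉ nbr i → t i j = 0)
    (z : 𝕜) (K : Finset ι)
    (X : (K → 𝕜) →ₗ[𝕜] (K → 𝕜))
    {θ nX yB nB yC nC MU2X : ℝ}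
    (hθ0 : 0 ≤ θ) (hθ1 : θ < 1) (hnX0 : 0 ≤ nX) (hyB0 : 0 ≤ yB) (hnB0 : 0 ≤ nB)
    (hyC0 : 0 ≤ yC) (hnC0 : 0 ≤ nC)
    (hθ : ∀ c : K → 𝕜,
      ∑ j : K, ‖c j - X (fun i : K => (z - (ℓ i : 𝕜)) * c i -
        ∑ j : K, (t i j * ((x₀ : 𝕜) - (ℓ j : 𝕜))) * c j) j‖ ^ 2 ≤ θ ^ 2 * ∑ j : K, ‖c j‖ ^ 2)
    (hnX : ∀ c : K → 𝕜, ∑ j : K, ‖X c j‖ ^ 2 ≤ nX ^ 2 * ∑ j : K, ‖c j‖ ^ 2)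
    (hyB : ∀ e : ι → 𝕜,
      ∑ j : K, ‖X (fun i : K => -∑ j ∈ nbr i \ K, (t i j * ((x₀ : 𝕜) - (ℓ j : 𝕜))) * e j) j‖ ^ 2 ≤
        yB ^ 2 * ∑ j ∈ K.biUnion nbr \ K, ‖e j‖ ^ 2)
    (hnB : ∀ e : ι → 𝕜,
      ∑ i : K, ‖∑ j ∈ nbr i \ K, (t i j * ((x₀ : 𝕜) - (ℓ j : 𝕜))) * e j‖ ^ 2 ≤
        nB ^ 2 * ∑ j ∈ K.biUnion nbr \ K, ‖e j‖ ^ 2)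
    (hyC : ∀ c : K → 𝕜,
      ∑ i ∈ K.biUnion nbr \ K, ‖∑ j : K, (t i j * ((x₀ : 𝕜) - (ℓ j : 𝕜))) * X c j‖ ^ 2 ≤
        yC ^ 2 * ∑ j : K, ‖c j‖ ^ 2)
    (hnC : ∀ w : K → 𝕜,
      ∑ i ∈ K.biUnion nbr \ K, ‖∑ j : K, (t i j * ((x₀ : 𝕜) - (ℓ j : 𝕜))) * w j‖ ^ 2 ≤
        nC ^ 2 * ∑ j : K, ‖w j‖ ^ 2)
    {s : ℝ} (sh : Finset ι) (hKsh : K.biUnion nbr \ K ⊆ sh)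
    (hshellX : ∀ e : ι → 𝕜, (∀ i ∈ K, e i = 0) →
      MU2X * ∑ i ∈ sh, ‖e i‖ ^ 2 ≤ ∑ i ∈ sh, (RCLike.re z - ℓ i - s) * ‖e i‖ ^ 2 -
        RCLike.re (∑ i ∈ K.biUnion nbr \ K,
          conj (∑ j : K, (t i j * ((x₀ : 𝕜) - (ℓ j : 𝕜))) *
            X (fun i : K => ∑ j ∈ nbr i \ K, (t i j * ((x₀ : 𝕜) - (ℓ j : 𝕜))) * e j) j) *
          e i))
    {α δ βB βC MU2 : ℝ} (hαdef : α = nX / (1 - θ)) (hδdef : δ = α * θ)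
    (hβBdef : βB = yB + nB * δ) (hβCdef : βC = yC + nC * δ)
    (hMU2def : MU2 = MU2X - nB * nC * δ) (hMU2 : 0 < MU2)
    (htail : ∀ i, i ∉ K → i ∉ sh → MU2 ≤ RCLike.re z - ℓ i - s)
    (hA : ∀ (F : Finset ι) (e : ι → 𝕜),
      RCLike.re (∑ i ∈ F, ∑ j ∈ F, conj (e i) * (t i j * ((x₀ : 𝕜) - (ℓ j : 𝕜))) * e j) ≤
        s * ∑ i ∈ F, ‖e i‖ ^ 2) :
    ∀ T' : H →L[𝕜] H, (∀ i j, ⟪b i, T' (b j)⟫_𝕜 = t i j) →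
      (∀ T'' : H →L[𝕜] H, (∀ i j, ⟪b i, T'' (b j)⟫_𝕜 = t i j) → T'' = T') →
      ∀ w, ((1 : H →L[𝕜] H) - T' - ((x₀ : 𝕜) - z) • b.diagonalCLM d) w = 0 → w = 0 := by
  obtain ⟨Binv, hBinv, hαM, hβBM, hβCM, hshellM⟩ :=
    exists_headInverse_of_approx K nbr (K.biUnion nbr \ K) sh le_rfl hKsh
      (fun i j => t i j * ((x₀ : 𝕜) - (ℓ j : 𝕜))) (fun i => z - (ℓ i : 𝕜))
      (fun i => RCLike.re z - ℓ i - s) X hθ0 hθ1 hnX0 hyB0 hnB0 hyC0 hnC0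
      hθ hnX hyB hnB hyC hnC hshellX hαdef hδdef hβBdef hβCdef hMU2def
  have hα : 0 ≤ α := by rw [hαdef]; exact div_nonneg hnX0 (by linarith)
  have hδ : 0 ≤ δ := by rw [hδdef]; positivity
  have hβB : 0 ≤ βB := by rw [hβBdef]; positivity
  have hβC : 0 ≤ βC := by rw [hβCdef]; positivity
  exact SkewCutGalerkinFromResolventData.resolventCoord_injective_of_sections b ℓ x₀ d hd hd0 t
    hrow hR hcol hC₀ hR0 hC0 hq nbr hsymm ht0 z K Binv hBinv hα hβB hβC hαM hβBM hβCM hMU2 sh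
    hshellM htail hA

end EndToEnd

end Summit.NavierStokesRegularity.FluidComputer.BorderedEigenpairFromApproxInverse

end
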